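import Mathlib

/-!
# Route `LeeYangFibres`, support `HyperbolicityClipsParity` (stmt-Parity-14114): interpolation and clipping

Helper file 2/·, two elementary real-variable lemmas of the clipping lemma:

* `multiaffine_coeff_bound` — **multiaffine interpolation on a two-point grid**: if a multiaffine
  form `g(x) = ∑_{T ⊆ U} c_T ∏_{k ∈ T} x_k` is bounded by `B` at every point of the grid
  `{n₀, n₁}^U` with `|n₀|, |n₁| ≤ 1` and `|n₀ - n₁| ≥ d > 0`, then every coefficient satisfies
  `|c_T| ≤ (2/d)^{#U} B` (induction on `U`: `g = g₀ + x_a g₁` and one-variable Lagrange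
  interpolation at the nodes `n₀, n₁`);
* `clip_abs_sub_le` — **the clipping inequality**: if `X, Y ∈ [-B, B]` admit non-negative
  `e`-perturbations `x₀ ≈ X`, `y₁, y₂ ≈ Y` with `x₀² ≥ (1-δ) y₁ y₂` and symmetrically
  `y₀² ≥ (1-δ) x₁ x₂`, then `|X - Y| ≤ δ B + 2 e` (Newton's inequality at an odd and an even bulk
  index with log-concavity margin `δ` clips the odd part `(X - Y)/2` of the fibre main term).

No named facts are used.
-/

namespace Summit.Parity.GeneralizedHardyLittlewood.Theorems.HyperbolicityClipsParity

open Finset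

/-- One-variable Lagrange step, coefficient of `x`: from `|c + n₀ c'|, |c + n₁ c'| ≤ A` and
`|n₀ - n₁| ≥ d > 0` we get `|c'| ≤ 2A/d`. -/
theorem lagrange_coeff_one {c c' n₀ n₁ d A : ℝ} (hd : 0 < d) (hsep : d ≤ |n₀ - n₁|)
    (h₀ : |c + n₀ * c'| ≤ A) (h₁ : |c + n₁ * c'| ≤ A) : |c'| ≤ 2 / d * A := by
  have hA : 0 ≤ A := (abs_nonneg _).trans h₀
  have hne : 0 < |n₀ - n₁| := hd.trans_le hsep
  have hkey : |n₀ - n₁| * |c'| ≤ 2 * A := by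
    rw [← abs_mul]
    have : (n₀ - n₁) * c' = (c + n₀ * c') - (c + n₁ * c') := by ring
    rw [this]
    exact (abs_sub _ _).trans (by linarith)
  have h2 : d * |c'| ≤ 2 * A := (mul_le_mul_of_nonneg_right hsep (abs_nonneg _)).trans hkey
  rw [div_mul_eq_mul_div, le_div_iff₀ hd]
  linarith

/-- One-variable Lagrange step, constant coefficient: from `|c + n₀ c'|, |c + n₁ c'| ≤ A`,
`|n₀|, |n₁| ≤ 1` and `|n₀ - n₁| ≥ d > 0` we get `|c| ≤ 2A/d`. -/
theorem lagrange_coeff_zero {c c' n₀ n₁ d A : ℝ} (hd : 0 < d) (hsep : d ≤ |n₀ - n₁|)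
    (hn₀ : |n₀| ≤ 1) (hn₁ : |n₁| ≤ 1)
    (h₀ : |c + n₀ * c'| ≤ A) (h₁ : |c + n₁ * c'| ≤ A) : |c| ≤ 2 / d * A := by
  have hA : 0 ≤ A := (abs_nonneg _).trans h₀
  have hkey : |n₀ - n₁| * |c| ≤ 2 * A := by
    rw [← abs_mul]
    have : (n₀ - n₁) * c = n₀ * (c + n₁ * c') - n₁ * (c + n₀ * c') := by ring
    rw [this]
    refine (abs_sub _ _).trans ?_
    rw [abs_mul, abs_mul]
    have e1 : |n₀| * |c + n₁ * c'| ≤ 1 * A :=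
      mul_le_mul hn₀ h₁ (abs_nonneg _) zero_le_one
    have e2 : |n₁| * |c + n₀ * c'| ≤ 1 * A :=
      mul_le_mul hn₁ h₀ (abs_nonneg _) zero_le_one
    linarith
  have h2 : d * |c| ≤ 2 * A := (mul_le_mul_of_nonneg_right hsep (abs_nonneg _)).trans hkey
  rw [div_mul_eq_mul_div, le_div_iff₀ hd]
  linarith

/-- **Multiaffine interpolation on the grid `{n₀, n₁}^U`.** A multiaffine form
`∑_{T ⊆ U} c_T ∏_{k ∈ T} x_k` bounded by `B` on the grid (`|n₀|, |n₁| ≤ 1`, `|n₀ - n₁| ≥ d > 0`)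
has all coefficients bounded by `(2/d)^{#U} B`. -/
theorem multiaffine_coeff_bound {ι : Type*} [DecidableEq ι] {n₀ n₁ d : ℝ} (hd : 0 < d)
    (hsep : d ≤ |n₀ - n₁|) (hn₀ : |n₀| ≤ 1) (hn₁ : |n₁| ≤ 1) (B : ℝ) (U : Finset ι) :
    ∀ c : Finset ι → ℝ,
      (∀ x : ι → ℝ, (∀ k ∈ U, x k = n₀ ∨ x k = n₁) →
        |∑ T ∈ U.powerset, c T * ∏ k ∈ T, x k| ≤ B) →
      ∀ T ∈ U.powerset, |c T| ≤ (2 / d) ^ U.card * B := by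
  induction U using Finset.induction_on with
  | empty =>
    intro c hc T hT
    rw [Finset.powerset_empty, Finset.mem_singleton] at hT
    subst hT
    have := hc (fun _ => n₀) (by simp)
    simpa using this
  | insert a U ha ih =>
    intro c hc T hT
    -- the two specialisations `x_a = n₀`, `x_a = n₁`
    have hspec : ∀ n : ℝ, (n = n₀ ∨ n = n₁) →
        ∀ x : ι → ℝ, (∀ k ∈ U, x k = n₀ ∨ x k = n₁) →
          |∑ T ∈ U.powerset, (c T + n * c (insert a T)) * ∏ k ∈ T, x k| ≤ B := by
      intro n hn x hx
      have hx' : ∀ k ∈ insert a U, Function.update x a n k = n₀ ∨ Function.update x a n k = n₁ := by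
        intro k hk
        rcases Finset.mem_insert.1 hk with rfl | hk
        · simpa using hn
        · have hka : k ≠ a := fun h => ha (h ▸ hk)
          rw [Function.update_of_ne hka]
          exact hx k hk
      have h := hc (Function.update x a n) hx'
      rw [Finset.sum_powerset_insert ha] at h
      have hprodU : ∀ T ∈ U.powerset, ∏ k ∈ T, Function.update x a n k = ∏ k ∈ T, x k := by
        intro T hT
        refine Finset.prod_congr rfl fun k hk => ?_
        have hka : k ≠ a := fun h => ha (h ▸ Finset.mem_powerset.1 hT hk)
        rw [Function.update_of_ne hka]
      have hprodI : ∀ T ∈ U.powerset,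
          ∏ k ∈ insert a T, Function.update x a n k = n * ∏ k ∈ T, x k := by
        intro T hT
        have haT : a ∉ T := fun h => ha (Finset.mem_powerset.1 hT h)
        rw [Finset.prod_insert haT, Function.update_self, hprodU T hT]
      have hsum : ∑ T ∈ U.powerset, (c T + n * c (insert a T)) * ∏ k ∈ T, x k =
          ∑ T ∈ U.powerset, c T * ∏ k ∈ T, Function.update x a n k +
            ∑ T ∈ U.powerset, c (insert a T) * ∏ k ∈ insert a T, Function.update x a n k := by
        rw [← Finset.sum_add_distrib]
        refine Finset.sum_congr rfl fun T hT => ?_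
        rw [hprodU T hT, hprodI T hT]; ring
      rw [hsum]; exact h
    have ih₀ := ih (fun T => c T + n₀ * c (insert a T)) (hspec n₀ (Or.inl rfl))
    have ih₁ := ih (fun T => c T + n₁ * c (insert a T)) (hspec n₁ (Or.inr rfl))
    have hpow : (2 / d) ^ (insert a U).card * B = 2 / d * ((2 / d) ^ U.card * B) := by
      rw [Finset.card_insert_of_notMem ha, pow_succ]; ring
    rw [hpow]
    by_cases haT : a ∈ T
    · -- `T = insert a T'` with `T' ⊆ U`
      have hT' : T.erase a ∈ U.powerset := by
        rw [Finset.mem_powerset]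
        intro k hk
        have hk' := Finset.mem_powerset.1 hT (Finset.mem_of_mem_erase hk)
        rcases Finset.mem_insert.1 hk' with rfl | h
        · exact absurd hk (Finset.notMem_erase k T)
        · exact h
      have hins : insert a (T.erase a) = T := Finset.insert_erase haT
      have e₀ := ih₀ (T.erase a) hT'
      have e₁ := ih₁ (T.erase a) hT'
      simp only [hins] at e₀ e₁
      exact lagrange_coeff_one hd hsep e₀ e₁
    · have hTU : T ∈ U.powerset := by
        rw [Finset.mem_powerset]
        intro k hk
        rcases Finset.mem_insert.1 (Finset.mem_powerset.1 hT hk) with rfl | h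
        · exact absurd hk haT
        · exact h
      exact lagrange_coeff_zero hd hsep hn₀ hn₁ (ih₀ T hTU) (ih₁ T hTU)

/-- One half of the clipping inequality: from `x₀ ≤ X + e`, `0 ≤ x₀`, `y₁, y₂ ≥ Y - e`,
`x₀² ≥ (1-δ) y₁ y₂`, `0 ≤ δ ≤ 1` and `Y ≤ B` we get `Y - X ≤ δ B + 2e`. -/
theorem clip_half {δ e B X Y x₀ y₁ y₂ : ℝ} (hδ0 : 0 ≤ δ) (hδ1 : δ ≤ 1) (he : 0 ≤ e)
    (hYB : Y ≤ B) (hx₀ : x₀ ≤ X + e) (hx₀0 : 0 ≤ x₀) (hy₁ : Y - e ≤ y₁) (hy₂ : Y - e ≤ y₂)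
    (hN : (1 - δ) * (y₁ * y₂) ≤ x₀ ^ 2) : Y - X ≤ δ * B + 2 * e := by
  -- key: `(1 - δ)(Y - e) ≤ x₀`
  have hkey : (1 - δ) * (Y - e) ≤ x₀ := by
    by_cases hYe : Y - e ≤ 0
    · exact le_trans (mul_nonpos_of_nonneg_of_nonpos (by linarith) hYe) hx₀0
    · push Not at hYe
      have hprod : (Y - e) ^ 2 ≤ y₁ * y₂ := by
        rw [sq]; exact mul_le_mul hy₁ hy₂ hYe.le (hYe.le.trans hy₁)
      have h1 : ((1 - δ) * (Y - e)) ^ 2 ≤ x₀ ^ 2 := by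
        have hd1 : (1 - δ) ^ 2 ≤ (1 - δ) := by nlinarith
        calc ((1 - δ) * (Y - e)) ^ 2 = (1 - δ) ^ 2 * (Y - e) ^ 2 := by ring
          _ ≤ (1 - δ) * (Y - e) ^ 2 := by
              exact mul_le_mul_of_nonneg_right hd1 (sq_nonneg _)
          _ ≤ (1 - δ) * (y₁ * y₂) := mul_le_mul_of_nonneg_left hprod (by linarith)
          _ ≤ x₀ ^ 2 := hN
      have h0 : 0 ≤ (1 - δ) * (Y - e) := mul_nonneg (by linarith) hYe.le
      exact (pow_le_pow_iff_left₀ h0 hx₀0 two_ne_zero).1 h1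
  have hδY : δ * Y ≤ δ * B := mul_le_mul_of_nonneg_left hYB hδ0
  nlinarith [hkey, hδY, mul_nonneg hδ0 he]

/-- **The clipping inequality.** `X, Y ∈ [-B, B]`; at an odd bulk index the normalised fibre
coefficients are `x₀ ≈ X` (centre) and `y₁, y₂ ≈ Y` (neighbours), at an even one `y₀ ≈ Y` and
`x₁, x₂ ≈ X`, all within `e` and non-negative; Newton with margin `δ` at both indices forces
`|X - Y| ≤ δ B + 2 e`. -/
theorem clip_abs_sub_le {δ e B X Y x₀ y₁ y₂ y₀ x₁ x₂ : ℝ} (hδ0 : 0 ≤ δ) (hδ1 : δ ≤ 1)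
    (he : 0 ≤ e) (hX : |X| ≤ B) (hY : |Y| ≤ B)
    (hx₀ : |x₀ - X| ≤ e) (hy₁ : |y₁ - Y| ≤ e) (hy₂ : |y₂ - Y| ≤ e)
    (hy₀ : |y₀ - Y| ≤ e) (hx₁ : |x₁ - X| ≤ e) (hx₂ : |x₂ - X| ≤ e)
    (hx₀0 : 0 ≤ x₀) (hy₀0 : 0 ≤ y₀)
    (hN₁ : (1 - δ) * (y₁ * y₂) ≤ x₀ ^ 2) (hN₂ : (1 - δ) * (x₁ * x₂) ≤ y₀ ^ 2) :
    |X - Y| ≤ δ * B + 2 * e := by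
  rw [abs_le] at hX hY hx₀ hy₁ hy₂ hy₀ hx₁ hx₂
  have h1 : Y - X ≤ δ * B + 2 * e :=
    clip_half hδ0 hδ1 he hY.2 (by linarith) hx₀0 (by linarith) (by linarith) hN₁
  have h2 : X - Y ≤ δ * B + 2 * e :=
    clip_half hδ0 hδ1 he hX.2 (by linarith) hy₀0 (by linarith) (by linarith) hN₂
  rw [abs_le]
  constructor <;> linarith

end Summit.Parity.GeneralizedHardyLittlewood.Theorems.HyperbolicityClipsParity
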